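import Summits.HodgeConjecture.HodgeConjecture.Theses.EndoscopicMiddleDegree
import Literature.AlgebraicGeometry.Motives.ComplexPointsOrientation
import Literature.AlgebraicTopology.SingularHomology.PoincareDualityProofs

/-!
# Crux `AlgebraicOrEnveloped` (stmt-HodgeConjecture-14943) — line `Sketch`: REMARKS companion

The two closed compositions of the lead's skeleton `Lines/Sketch.lean` (same vocabulary, restated
minimally and self-contained): the card's `HullShadowSplit → ShadowKernelEnveloped → AlgebraicOrEnveloped`
and the reshaped `AlgebraicKernelSplit → AlgebraicKernelEnveloped → AlgebraicOrEnveloped`, showing that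
the WEAKER residual `AlgebraicKernelEnveloped` (envelope the rational Hodge classes cup-orthogonal to
ALL algebraic classes) already closes the crux with the Hodge–Riemann split; and
`algebraicKernelEnveloped_of_orthogonalEnveloped`: that residual is implied by the sibling crux
`OrthogonalEnveloped` (its theta world is algebraic), so it is the weakest typed form of the
automorphic heart on this route. Kept out of the skeleton so that the skeleton has exactly one theorem
concluding the crux.
-/

noncomputable section

set_option linter.dupNamespace false

open CategoryTheory MonoidalCategory CartesianMonoidalCategory
open Literature.AlgebraicGeometry.Motives Literature.AlgebraicGeometry.HodgeTheory
open Literature.AlgebraicGeometry.ShimuraVarieties Literature.AlgebraicTopology.SingularHomology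

namespace Summit.HodgeConjecture.HodgeConjecture.Cruxes.AlgebraicOrEnveloped.HullGysinRemarks

/-! ### Vocabulary of the line -/

/-- Degree bookkeeping of the hull Gysin map `ι_* : H^{2(m+1)}(X) → H^{4(m+1)}(X')`,
`dim X = 2(m+1)`, `dim X' = 3(m+1)`. -/
theorem hull_deg (m : ℕ) :
    2 * (m + 1) + 2 * (3 * (m + 1)) = 2 * (2 * (m + 1)) + 2 * (2 * (m + 1)) := by ring

/-- The hull Gysin map `ι_* = complexGysin μ hX hX' ι : H^{2(m+1)}(X(ℂ); ℂ) → H^{4(m+1)}(X'(ℂ); ℂ)`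
of a morphism `ι : X ⟶ X'` from the `2(m+1)`-fold `X` to a `3(m+1)`-fold `X'`. -/
def hullGysin (μ : OrientationFamily) {m : ℕ} {X X' : SchemeOver ℂ}
    (hX : IsSmoothProjective (2 * (m + 1)) X) (hX' : IsSmoothProjective (3 * (m + 1)) X')
    (ι : X ⟶ X') : complexBetti X (2 * (m + 1)) →ₗ[ℂ] complexBetti X' (2 * (2 * (m + 1))) :=
  complexGysin μ hX hX' ι (hull_deg m)

/-- `HullHC m X'`: the Hodge conjecture for rational `(m+1, m+1)`-classes in degree `2(m+1)` on the
`3(m+1)`-fold `X'` (for the unitary hull of a ball quotient: BMM Cor. 2 at `(p, n) = (3n, n)`). -/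
def HullHC (m : ℕ) (X' : SchemeOver ℂ) : Prop :=
  ∀ a : complexBetti X' (2 * (m + 1)), IsRationalClass a →
    IsOfHodgeType (3 * (m + 1)) X' (2 * (m + 1)) (m + 1) (m + 1) a → a ∈ algebraicClasses X' (m + 1)

/-- The SHADOW KERNEL condition: `e` is killed by `ι_*` for every admissible hull, i.e. every
smooth projective `3(m+1)`-fold `X'` satisfying `HullHC` and every morphism `ι : X ⟶ X'`. -/
def ShadowKernel (μ : OrientationFamily) {m : ℕ} {X : SchemeOver ℂ}
    (hX : IsSmoothProjective (2 * (m + 1)) X) (e : complexBetti X (2 * (m + 1))) : Prop :=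
  ∀ (X' : SchemeOver ℂ) (hX' : IsSmoothProjective (3 * (m + 1)) X') (ι : X ⟶ X'),
    HullHC m X' → hullGysin μ hX hX' ι e = 0

/-- `e` is cup-orthogonal to every algebraic class of complementary degree:
`e ∪ x = 0 ∈ H^{4(m+1)}(X(ℂ); ℂ)` for all `x ∈ algebraicClasses X (m+1)`. -/
def AlgOrthogonal (m : ℕ) (X : SchemeOver ℂ) (e : complexBetti X (2 * (m + 1))) : Prop :=
  ∀ x ∈ algebraicClasses X (m + 1), cupProduct (two_mul_add_two_mul (m + 1) (m + 1)) e x = 0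

/-- The correspondence action `P_γ β = pr₁₊(pr₂^* β ∪ γ)` of the crux, verbatim (`pr₁₊ =
complexGysin μ` of the first projection of `X ⊗ X`, `X` with its datum `D`). -/
def envelopeAction (μ : OrientationFamily) (m : ℕ) (X : SchemeOver ℂ)
    (D : UnitaryBallQuotientDatum (2 * (m + 1)) X)
    (γ : complexBetti (X ⊗ X) (2 * (2 * (m + 1)))) :
    complexBetti X (2 * (m + 1)) → complexBetti X (2 * (m + 1)) :=
  fun β => complexGysin μ (IsSmoothProjective.tensor_holds D.isSmoothProjective D.isSmoothProjective)
    D.isSmoothProjective (fst X X)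
    (show 2 * (m + 1) + 2 * (2 * (m + 1)) + 2 * (2 * (m + 1)) =
      2 * (m + 1) + 2 * (2 * (m + 1) + 2 * (m + 1)) by ring)
    (cupProduct (rfl : 2 * (m + 1) + 2 * (2 * (m + 1)) = 2 * (m + 1) + 2 * (2 * (m + 1)))
      (complexBetti.map (snd X X) (2 * (m + 1)) β) γ)

/-- `e` is ENVELOPED (for `μ`): some algebraic `γ ∈ N^{2(m+1)} H^{4(m+1)}((X ⊗ X)(ℂ); ℂ)` has an
action `P_γ` preserving rational classes, with purely `(m+1, m+1)` image, fixing `e` — the crux's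
envelope clause verbatim. -/
def IsEnveloped (μ : OrientationFamily) (m : ℕ) (X : SchemeOver ℂ)
    (D : UnitaryBallQuotientDatum (2 * (m + 1)) X) (e : complexBetti X (2 * (m + 1))) : Prop :=
  ∃ γ ∈ algebraicClasses (X ⊗ X) (2 * (m + 1)),
    (∀ β, IsRationalClass β → IsRationalClass (envelopeAction μ m X D γ β)) ∧
    (∀ β, IsOfHodgeType (2 * (m + 1)) X (2 * (m + 1)) (m + 1) (m + 1) (envelopeAction μ m X D γ β)) ∧
    envelopeAction μ m X D γ e = e

/-! ### The typed statements -/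

/-- `HullShadowSplit` (the card's first half): with HC in degree `2m` on `X`, every rational Hodge
`(m+1,m+1)`-class lies in `algebraicClasses X (m+1) ⊔ span {e rational Hodge : ∃ μ with Poincaré
duality, ShadowKernel μ _ e}`. -/
def HullShadowSplit : Prop :=
  ∀ (m : ℕ) (X : SchemeOver ℂ) (D : UnitaryBallQuotientDatum (2 * (m + 1)) X), 1 ≤ m → m ≤ 2 →
    (∀ a : complexBetti X (2 * m), IsRationalClass a →
      IsOfHodgeType (2 * (m + 1)) X (2 * m) m m a → a ∈ algebraicClasses X m) →
    ∀ c : complexBetti X (2 * (m + 1)), IsRationalClass c →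
      IsOfHodgeType (2 * (m + 1)) X (2 * (m + 1)) (m + 1) (m + 1) c →
      c ∈ algebraicClasses X (m + 1) ⊔ Submodule.span ℂ {e : complexBetti X (2 * (m + 1)) |
        IsRationalClass e ∧ IsOfHodgeType (2 * (m + 1)) X (2 * (m + 1)) (m + 1) (m + 1) e ∧
        ∃ μ : OrientationFamily, μ.HasPoincareDuality ∧ ShadowKernel μ D.isSmoothProjective e}

/-- `ShadowKernelEnveloped` (the card's second half, THE BET): every rational Hodge class in the
shadow kernel is enveloped. -/
def ShadowKernelEnveloped : Prop :=
  ∀ (μ : OrientationFamily), μ.HasPoincareDuality →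
    ∀ (m : ℕ) (X : SchemeOver ℂ) (D : UnitaryBallQuotientDatum (2 * (m + 1)) X), 1 ≤ m → m ≤ 2 →
    (∀ a : complexBetti X (2 * m), IsRationalClass a →
      IsOfHodgeType (2 * (m + 1)) X (2 * m) m m a → a ∈ algebraicClasses X m) →
    ∀ e : complexBetti X (2 * (m + 1)), IsRationalClass e →
      IsOfHodgeType (2 * (m + 1)) X (2 * (m + 1)) (m + 1) (m + 1) e →
      ShadowKernel μ D.isSmoothProjective e → IsEnveloped μ m X D e

/-- `AlgebraicKernelSplit`: with HC in degree `2m` on `X`, every rational Hodge `(m+1,m+1)`-class lies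
in `algebraicClasses X (m+1) ⊔ span {e rational Hodge : AlgOrthogonal m X e}` (Hodge–Riemann). -/
def AlgebraicKernelSplit : Prop :=
  ∀ (m : ℕ) (X : SchemeOver ℂ) (_D : UnitaryBallQuotientDatum (2 * (m + 1)) X), 1 ≤ m → m ≤ 2 →
    (∀ a : complexBetti X (2 * m), IsRationalClass a →
      IsOfHodgeType (2 * (m + 1)) X (2 * m) m m a → a ∈ algebraicClasses X m) →
    ∀ c : complexBetti X (2 * (m + 1)), IsRationalClass c →
      IsOfHodgeType (2 * (m + 1)) X (2 * (m + 1)) (m + 1) (m + 1) c →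
      c ∈ algebraicClasses X (m + 1) ⊔ Submodule.span ℂ {e : complexBetti X (2 * (m + 1)) |
        IsRationalClass e ∧ IsOfHodgeType (2 * (m + 1)) X (2 * (m + 1)) (m + 1) (m + 1) e ∧
        AlgOrthogonal m X e}

/-- `AlgebraicKernelEnveloped` (the WEAKER residual): every rational Hodge class cup-orthogonal to
all algebraic classes is enveloped. Implied by `ShadowKernelEnveloped` through
`GysinNullOfAlgOrthogonal`, and sufficient for the crux with `AlgebraicKernelSplit`. -/
def AlgebraicKernelEnveloped : Prop :=
  ∀ (μ : OrientationFamily), μ.HasPoincareDuality →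
    ∀ (m : ℕ) (X : SchemeOver ℂ) (D : UnitaryBallQuotientDatum (2 * (m + 1)) X), 1 ≤ m → m ≤ 2 →
    (∀ a : complexBetti X (2 * m), IsRationalClass a →
      IsOfHodgeType (2 * (m + 1)) X (2 * m) m m a → a ∈ algebraicClasses X m) →
    ∀ e : complexBetti X (2 * (m + 1)), IsRationalClass e →
      IsOfHodgeType (2 * (m + 1)) X (2 * (m + 1)) (m + 1) (m + 1) e →
      AlgOrthogonal m X e → IsEnveloped μ m X D e

/-- An orientation family with Poincaré duality exists: the complex orientations
(`Motives.ComplexPoints.isOrientableOver`) with Hatcher Thm. 3.30 (`poincare_duality`). -/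
theorem exists_orientationFamily_hasPoincareDuality :
    ∃ μ : OrientationFamily, μ.HasPoincareDuality :=
  ⟨fun _ _ h ↦ Classical.choice (ComplexPoints.isOrientableOver ℂ h),
    OrientationFamily.hasPoincareDuality_of (fun ν _ _ h ↦ poincare_duality ν h) _⟩

/-! ### The two closed compositions -/

/-- **The card's composition**: `HullShadowSplit → ShadowKernelEnveloped → AlgebraicOrEnveloped`. -/
theorem algebraicOrEnveloped_of_hullShadow (h₁ : HullShadowSplit) (h₃ : ShadowKernelEnveloped) :
    Theses.EndoscopicMiddleDegree.AlgebraicOrEnveloped := by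
  intro m X D hm1 hm2 hlow c hc hH
  refine SetLike.le_def.1 (sup_le_sup_left (Submodule.span_mono ?_) _) (h₁ m X D hm1 hm2 hlow c hc hH)
  rintro e ⟨he, heH, μ, hμ, hsh⟩
  obtain ⟨γ, hγ, hrat, hhodge, hfix⟩ := h₃ μ hμ m X D hm1 hm2 hlow e he heH hsh
  exact ⟨he, μ, hμ, γ, hγ, hrat, hhodge, hfix⟩

/-- **The reshaped composition**: `AlgebraicKernelSplit → AlgebraicKernelEnveloped →
AlgebraicOrEnveloped` (at the complex orientation family). -/
theorem algebraicOrEnveloped_of_algebraicKernel (h₁ : AlgebraicKernelSplit)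
    (h₃ : AlgebraicKernelEnveloped) : Theses.EndoscopicMiddleDegree.AlgebraicOrEnveloped := by
  intro m X D hm1 hm2 hlow c hc hH
  obtain ⟨μ, hμ⟩ := exists_orientationFamily_hasPoincareDuality
  refine SetLike.le_def.1 (sup_le_sup_left (Submodule.span_mono ?_) _) (h₁ m X D hm1 hm2 hlow c hc hH)
  rintro e ⟨he, heH, horth⟩
  obtain ⟨γ, hγ, hrat, hhodge, hfix⟩ := h₃ μ hμ m X D hm1 hm2 hlow e he heH horth
  exact ⟨he, μ, hμ, γ, hγ, hrat, hhodge, hfix⟩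

/-! ### The reshaped residual is weaker than the sibling crux `OrthogonalEnveloped` -/

/-- **`OrthogonalEnveloped → AlgebraicKernelEnveloped`** (given `CupProductAlgebraic` for the Lefschetz
summand): the theta world `TW(D)` of `OrthogonalEnveloped` consists of ALGEBRAIC classes — special cycle
classes and cycles-on-special-cycles are supported in codimension `≥ m+1`
(`classesSupportedOn_le_supportedClasses` with the datum's closedness / codimension fields), the
Lefschetz summand `a ∪ d` is algebraic by the degree-`2m` hypothesis and `CupProductAlgebraic` — so a
class cup-orthogonal to all algebraic classes is cup-orthogonal to `TW(D)`, and `OrthogonalEnveloped`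
envelopes it. Hence the line's residual bet is implied by crux #4 of the route (and not conversely
without exhibiting theta classes). -/
theorem algebraicKernelEnveloped_of_orthogonalEnveloped
    (hcup : Theses.EndoscopicMiddleDegree.CupProductAlgebraic)
    (h : Theses.EndoscopicMiddleDegree.OrthogonalEnveloped) : AlgebraicKernelEnveloped := by
  intro μ hμ m X D hm1 hm2 hlow e he heH horth
  have hX : IsSmoothProjective (2 * (m + 1)) X := D.isSmoothProjective
  have hTW : ((⨆ (W : Submodule D.E (Fin (2 * (m + 1) + 1) → D.E))
      (_ : IsTotallyPositive (conjRingHom D.E) D.H W) (_ : Module.finrank D.E W = m + 1),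
      classesSupportedOn X (D.specialSubvariety W) (2 * (m + 1))) ⊔
    (⨆ (W : Submodule D.E (Fin (2 * (m + 1) + 1) → D.E))
      (_ : IsTotallyPositive (conjRingHom D.E) D.H W) (_ : Module.finrank D.E W = m)
      (Z : Set X.left) (_ : IsClosed Z) (_ : Z ⊆ D.specialSubvariety W)
      (_ : ∀ z ∈ Z, ((m + 1 : ℕ) : ℕ∞) ≤ Order.coheight z),
      classesSupportedOn X Z (2 * (m + 1))) ⊔
    Submodule.span ℂ {z : complexBetti X (2 * (m + 1)) |
      ∃ a : complexBetti X (2 * m), IsRationalClass a ∧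
        IsOfHodgeType (2 * (m + 1)) X (2 * m) m m a ∧ ∃ d ∈ algebraicClasses X 1,
          z = cupProduct (two_mul_add_two_mul m 1) a d}) ≤ algebraicClasses X (m + 1) := by
    refine sup_le (sup_le ?_ ?_) ?_
    · refine iSup_le fun W ↦ iSup_le fun hW ↦ iSup_le fun hk ↦
        classesSupportedOn_le_supportedClasses (D.isClosed_specialSubvariety W hW) (fun z hz ↦ ?_) _
      have := D.le_coheight_of_mem_specialSubvariety W hW z hz
      rw [hk] at this
      exact_mod_cast this
    · exact iSup_le fun _ ↦ iSup_le fun _ ↦ iSup_le fun _ ↦ iSup_le fun _ ↦ iSup_le fun hZ ↦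
        iSup_le fun _ ↦ iSup_le fun hk ↦ classesSupportedOn_le_supportedClasses hZ hk _
    · refine Submodule.span_le.2 ?_
      rintro z ⟨a, ha, haH, d, hd, rfl⟩
      exact hcup hX m 1 a d (hlow a ha haH) hd
  obtain ⟨γ, hγ, hrat, hhodge, hfix⟩ :=
    h μ hμ m X D hm1 hm2 e he heH (fun x hx ↦ horth x (hTW hx))
  exact ⟨γ, hγ, hrat, hhodge, hfix⟩

end Summit.HodgeConjecture.HodgeConjecture.Cruxes.AlgebraicOrEnveloped.HullGysinRemarks

end
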